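import Literature.NumberTheory.EllipticCurves.KellerYin2024.AnomalousLambdaInvariants
import Literature.NumberTheory.EllipticCurves.HeegnerPointsKolyvaginConjugation
import Literature.NumberTheory.GaloisRepresentations.AbsGaloisOuterConj
import HarnessLib

/-!
# The residual pair `(θsub, θquot)` of `E[p]` over `K` for `E/ℚ` is stable under the outer action of
# `Γ_ℚ` (Keller–Yin 2024 §1.4 / CGLS 2022 Thm. 2.2.2 — proved reading lemma)

`Proofs`-type file (THEOREMS ONLY: no definition, no named fact, no instance) in topic
`NumberTheory/EllipticCurves`, paper namespace `KellerYin2024`, companion of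
`AnomalousLambdaInvariants.lean` (the predicate `IsResidualPairOver WK p θsub θquot`: "`θsub` is the
Teichmüller lift of the character of `Γ_K` on a stable line `Φ ≤ E[p](K̄)`, `θquot` that of
`E[p]/Φ`") and of `ResidualPairUniqueness.lean`.

PRINT. Castella–Grossi–Lee–Skinner 2022, Thm. 2.2.2 and Keller–Yin 2024, §1.4 (arXiv:2402.12781v2
TeX L1066–1081) speak of THE characters `φ, ψ` of `E[p]^{ss} = 𝔽_p(φ) ⊕ 𝔽_p(ψ)` as
`G_ℚ`-characters, restricted to `G_K`; the tree's CGLS-2.2.2-shaped named facts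
`KellerYin2024.thm222_anacong_goodLattice_*` bind instead `∀ θsub θquot,
IsResidualPairOver (W.baseChange K) p θsub θquot → …`, a predicate over `Γ_K` only.  PROVED HERE:
for `W : WeierstrassCurve ℚ`, `K` a number field Galois over `ℚ` and `τ ∈ Γ_ℚ`, the CONJUGATE pair
`(θsub ∘ θ_τ, θquot ∘ θ_τ)` (`FramedGaloisRep.outerConj τ`, `θ_τ σ = res⁻¹(τ · res σ · τ⁻¹)` the
outer action of `GaloisRepresentations/AbsGaloisOuterConj.lean`) is again a residual pair of
`E[p]` over `K` (`IsResidualPairOver.outerConj`): its stable line is `T(Φ)` for the additive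
automorphism `T = e ∘ τ⁻¹ ∘ e⁻¹` of `E(K̄)` transported from the action of `τ⁻¹` on `E(ℚ̄)` along the
tree's `Γ_K`-equivariant `RatClosure.pointsEquiv : E(ℚ̄) ≃ E(K̄)`, which satisfies
`σ • T(P) = T(θ_τ(σ) • P)` (`smul_ratOuterConjPoints`).  Consequence (not here, Summits-side, where
the uniqueness of the residual pair for the good lattice lives —
`…Theorems.GoodLatticeStableLineUnique.residualPair_unique_of_anom`): inside crux 2 of cell
`bsd-eis` the residual pair is FIXED by the outer action, the hypothesis of the conjugate-places
reading lemmas of `AnticyclotomicLocalEulerFactorsConjugatePlaces.lean` §3.  No summit statement,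
no case of BSD, no crux or stub is proved by this file.

## References
* [KellerYin2024] arXiv:2402.12781v2, §1.4 display (char to f) (TeX L1066–1081), §1.1 (L441).
* [CastellaGrossiLeeSkinner2022] Invent. Math. 227 (2022), Thm. 2.2.2 (hypothesis
  "`E[p]^{ss} = 𝔽_p(φ) ⊕ 𝔽_p(ψ)`" as `G_ℚ`-modules) and its proof ((eq:Euler-comp)).
* [SerreLinearRepresentations1977] §7.2 (conjugate representations of a normal subgroup).
* [SilvermanAEC2009] VIII.§1 (Galois action on `E(K̄)`).
-/

noncomputable section

open scoped Classical Pointwise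
open NumberField Field WeierstrassCurve
open Literature.NumberTheory.EllipticCurves Literature.NumberTheory.GaloisRepresentations

namespace Literature.NumberTheory.EllipticCurves.KellerYin2024

section OuterConj

variable {K : Type} [Field K] [NumberField K] [IsGalois ℚ K] (W : WeierstrassCurve ℚ)

/-- **`σ • T(P) = T(θ_τ(σ) • P)`** for the additive automorphism `T = e ∘ τ⁻¹ ∘ e⁻¹` of `E(K̄)`
(`e = RatClosure.pointsEquiv : E(ℚ̄) ≃ E(K̄)`, `Γ_K`-equivariant along `res`) and the outer action
`θ_τ` (`res(θ_τ σ) = τ · res σ · τ⁻¹`): the pair `(θ_τ, T)` is a compatible pair in the sense of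
Serre, *Galois Cohomology* I.§2.4 — the elliptic-curve avatar of "`ρ^τ(σ) = ρ(τ σ τ⁻¹)`".
[cite: SerreLinearRepresentations1977, §7.2 (conjugate representations of a normal subgroup)]
[cite: SilvermanAEC2009, VIII.§1 (Galois action on E(K̄))] -/
theorem smul_ratOuterConjPoints (τ : absoluteGaloisGroup ℚ) (σ : absoluteGaloisGroup K)
    (P : geomPoints (W.baseChange K)) :
    σ • ((RatClosure.pointsEquiv (K := K) W).symm.trans
        ((DistribMulAction.toAddEquiv (geomPoints W) τ⁻¹).trans (RatClosure.pointsEquiv (K := K) W))) P =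
      ((RatClosure.pointsEquiv (K := K) W).symm.trans
        ((DistribMulAction.toAddEquiv (geomPoints W) τ⁻¹).trans (RatClosure.pointsEquiv (K := K) W)))
        (absGaloisOuterConj ℚ K τ σ • P) := by
  set e := RatClosure.pointsEquiv (K := K) W with he
  simp only [AddEquiv.trans_apply, DistribMulAction.toAddEquiv_apply]
  -- `res σ' • e⁻¹ Q = e⁻¹ (σ' • Q)` for `σ' ∈ Γ_K`
  have hsymm : ∀ (σ' : absoluteGaloisGroup K) (Q : geomPoints (W.baseChange K)),
      absGaloisRestrict ℚ K σ' • e.symm Q = e.symm (σ' • Q) := fun σ' Q ↦ by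
    apply e.injective
    rw [RatClosure.pointsEquiv_smul, AddEquiv.apply_symm_apply, AddEquiv.apply_symm_apply]
  rw [← hsymm, absGaloisRestrict_absGaloisOuterConj, ← RatClosure.pointsEquiv_smul, ← mul_smul,
    ← mul_smul, he]
  congr 2
  group

/-- **The conjugate of a residual pair is a residual pair.** For `E/ℚ` (model `W`), `K` a number
field Galois over `ℚ`, `τ ∈ Γ_ℚ` and a residual pair `(θsub, θquot)` of `E[p]` over `K`
(`IsResidualPairOver (W.baseChange K) p θsub θquot`, stable line `Φ`), the pair
`(θsub ∘ θ_τ, θquot ∘ θ_τ)` (`FramedGaloisRep.outerConj τ`) is a residual pair, with stable line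
`T(Φ)`, `T = e ∘ τ⁻¹ ∘ e⁻¹` (`smul_ratOuterConjPoints`).  In print both `φ, ψ` are `G_ℚ`-characters
and the issue does not arise. [cite: KellerYin2024, §1.4 display (char to f) (arXiv:2402.12781v2 TeX L1066–1081)]
[cite: CastellaGrossiLeeSkinner2022, Thm. 2.2.2 (hypothesis "E[p]^ss = 𝔽_p(φ) ⊕ 𝔽_p(ψ)" as G_ℚ-modules)] -/
theorem IsResidualPairOver.outerConj {p : ℕ} [Fact p.Prime] {S : Set (PadicAlgCl p)}
    {θsub θquot : FramedGaloisRep K (padicCoeffIntegers S) 1}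
    (h : IsResidualPairOver (W.baseChange K) p θsub θquot) (τ : absoluteGaloisGroup ℚ) :
    IsResidualPairOver (W.baseChange K) p (θsub.outerConj τ) (θquot.outerConj τ) := by
  obtain ⟨Φ, hcard, hle, hstab, hsub, hquot⟩ := h
  set T : geomPoints (W.baseChange K) ≃+ geomPoints (W.baseChange K) :=
    (RatClosure.pointsEquiv (K := K) W).symm.trans
      ((DistribMulAction.toAddEquiv (geomPoints W) τ⁻¹).trans (RatClosure.pointsEquiv (K := K) W)) with hT
  have hσT : ∀ (σ : absoluteGaloisGroup K) (P : geomPoints (W.baseChange K)),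
      σ • T P = T (absGaloisOuterConj ℚ K τ σ • P) := fun σ P ↦ by
    rw [hT]; exact smul_ratOuterConjPoints W τ σ P
  -- torsion is preserved by `T` and `T⁻¹`
  have htor : ∀ (f : geomPoints (W.baseChange K) ≃+ geomPoints (W.baseChange K))
      (Q : geomPoints (W.baseChange K)),
      Q ∈ geomTorsion (W.baseChange K) (p : ℤ) → f Q ∈ geomTorsion (W.baseChange K) (p : ℤ) :=
    fun f Q hQ ↦ by
      rw [mem_geomTorsion_iff] at hQ ⊢
      rw [← map_zsmul, hQ, map_zero]
  refine ⟨Φ.map T.toAddMonoidHom, ?_, ?_, ?_, ?_, ?_⟩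
  · -- same order
    rw [← hcard]
    exact Nat.card_congr (Φ.equivMapOfInjective T.toAddMonoidHom T.injective).toEquiv.symm
  · -- still `p`-torsion
    rintro _ ⟨P, hP, rfl⟩
    exact htor T P (hle hP)
  · -- `Γ_K`-stable
    rintro σ _ ⟨P, hP, rfl⟩
    refine ⟨absGaloisOuterConj ℚ K τ σ • P, hstab _ P hP, ?_⟩
    change T _ = σ • T P
    rw [hσT]
  · -- `θsub ∘ θ_τ` is the Teichmüller lift of the action on `T(Φ)`
    refine ⟨fun σ ↦ hsub.1 _, fun σ ↦ ?_⟩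
    obtain ⟨a, ha, hΦ⟩ := hsub.2 (absGaloisOuterConj ℚ K τ σ)
    refine ⟨a, ha, ?_⟩
    rintro _ ⟨P, hP, rfl⟩
    have h0 : absGaloisOuterConj ℚ K τ σ • P - a • P = 0 := AddSubgroup.mem_bot.mp (hΦ P hP)
    rw [AddSubgroup.mem_bot]
    change σ • T P - a • T P = 0
    rw [hσT, ← map_zsmul, ← map_sub, h0, map_zero]
  · -- `θquot ∘ θ_τ` is the Teichmüller lift of the action on `E[p]/T(Φ)`
    refine ⟨fun σ ↦ hquot.1 _, fun σ ↦ ?_⟩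
    obtain ⟨b, hb, hΦ⟩ := hquot.2 (absGaloisOuterConj ℚ K τ σ)
    refine ⟨b, hb, fun P' hP' ↦ ?_⟩
    have hP : T.symm P' ∈ geomTorsion (W.baseChange K) (p : ℤ) := htor T.symm P' hP'
    refine ⟨absGaloisOuterConj ℚ K τ σ • T.symm P' - b • T.symm P', hΦ _ hP, ?_⟩
    change T _ = σ • P' - b • P'
    rw [map_sub, map_zsmul, ← hσT, AddEquiv.apply_symm_apply]

/-- Pointwise form: if the residual pair over `K` is UNIQUE (e.g. the good lattice of crux 2, cell
`bsd-eis`: `…Theorems.GoodLatticeStableLineUnique.residualPair_unique_of_anom`), then both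
characters are FIXED by the outer action of `Γ_ℚ`: `θsub (θ_τ σ) = θsub σ`, `θquot (θ_τ σ) = θquot σ`
— the hypothesis of `AnticyclotomicLocalEulerFactorsConjugatePlaces` §3.
[cite: KellerYin2024, §1.4 display (char to f) (arXiv:2402.12781v2 TeX L1066–1081)]
[cite: CastellaGrossiLeeSkinner2022, Thm. 2.2.2 (φ, ψ as G_ℚ-characters)] -/
theorem IsResidualPairOver.apply_absGaloisOuterConj_of_unique {p : ℕ} [Fact p.Prime]
    {S : Set (PadicAlgCl p)} {θsub θquot : FramedGaloisRep K (padicCoeffIntegers S) 1}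
    (h : IsResidualPairOver (W.baseChange K) p θsub θquot)
    (huniq : ∀ θsub' θquot' : FramedGaloisRep K (padicCoeffIntegers S) 1,
      IsResidualPairOver (W.baseChange K) p θsub' θquot' → θsub' = θsub ∧ θquot' = θquot)
    (τ : absoluteGaloisGroup ℚ) (σ : absoluteGaloisGroup K) :
    θsub (absGaloisOuterConj ℚ K τ σ) = θsub σ ∧ θquot (absGaloisOuterConj ℚ K τ σ) = θquot σ := by
  obtain ⟨h1, h2⟩ := huniq _ _ (h.outerConj W τ)
  exact ⟨by rw [← FramedGaloisRep.outerConj_apply, h1], by rw [← FramedGaloisRep.outerConj_apply, h2]⟩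

end OuterConj

end Literature.NumberTheory.EllipticCurves.KellerYin2024

end
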